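import Summits.QuantumFields.YangMills.Theorems.BalabanUVNodesN19SourcedResponse
import Literature.MathematicalPhysics.QuantumFieldTheory.Balaban1983to89.T4VitaliStep

/-!
# BalabanUVNodes ∕ N19 (NE7 proper) — THE WINDOW CARRIES ONLY THE RATE: under N19's DECL target on ANY source window `l₀ > 0` the string's
# generating functions, sourced expectations and sourced moments converge at EVERY real source (Vitali for the entire family
# `z ↦ ⟨e^{z∏os}⟩_K`, moved to every tilt by `cgf_tilted_mul`)

Cell `pub-ymgap` (HUMAN RULING D-0062, Track A), R141 (C) WIDER STRATEGY seat `pub-ymgap-dag-n19-e` (strategy s3 «alternative currency»), gen 8,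
third module; filed `--kind proof --supports` K3‴ `SpineGivenEndpointR13` = stmt-QuantumFields-19912 `--as helper` (route rev 17).  COUNT-NEUTRAL.
THEOREMS ONLY (0 `def`); imports this seat's `…N19SourcedResponse` (hence `…N19MGFJoinConverse`: `cgf_tilted_mul`, `isProbabilityMeasure_tilted_mul`;
and `deriv_genFun_schemeZ_eq_tiltedMean`) and the tree's node E3 `T4VitaliStep` (`tendsto_of_tendsto_at`, `tendsto_integral_of_tendsto_cgf`,
`tendsto_moment_of_tendsto_cgf`); edits nothing.

WHAT THIS IS.  The sibling `…N19SourcedResponse` gives, under `Spine.NE7.Target vol l₀ δ (schemeZ S os)`, convergence of the sourced expectations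
`G_K′(s)` for `|s| < l₀` WITH the lin-log tail rate.  Here the QUALITATIVE statement is freed from the window: the complex MGF's
`z ↦ ⟨e^{z·∏os}⟩_K` are ENTIRE and bounded by `e^{‖z‖}` uniformly in `K`, so convergence of the cgf's on `(0, l₀)` (from `Target`) propagates by the
tree's Vitali step (node E3) to EVERY `z ∈ ℂ` (`tendsto_complexMGF_all_of_tendsto_cgf`), hence the real MGF's converge at every real `t` to a limit
`≥ e^{−|t|B} > 0` and the cgf's ∕ generating functions converge at EVERY real source (`tendsto_cgf_all_of_tendsto_cgf`, ★ `tendsto_genFun_of_target_everySource`);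
and since the cgf of the source-tilted measure is the shifted cgf (`cgf_tilted_mul`, p497552), node E3 applied to the TILTED probability measures gives
convergence of the tilted means — the sourced expectations `G_K′(s)` — and of every tilted moment at EVERY tilt `s ∈ ℝ`
(`tendsto_tiltedMean_all_of_tendsto_cgf`, `tendsto_tiltedMoment_all_of_tendsto_cgf`; ★ `tendsto_deriv_genFun_of_target_everySource`,
`tendsto_sourcedMoment_of_target_everySource`).  So the window `l₀` of N19's target carries only the RATE (sibling), not the EXISTENCE of the limits.

HONEST FRAMING.  [folklore] complex analysis BY NAME (tree node E3 = Vitali on a disc; nothing new in analysis here) + Mathlib `Measure.tilted`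
bookkeeping; qualitative only (NO rate outside the window); `Target` is a HYPOTHESIS (NE7 NOT PRINTED as a two-run statement for d = 4, NOT
proved); nothing of Bałaban's is instantiated; N19 NOT discharged (0∕1); K3‴ NOT claimed; counts UNMOVED (5∕27).  One finite four-torus programme at
fixed `ε` — NOT ℝ⁴, NOT infinite volume, NOT OS, NOT a mass gap, NOT Clay.  0 `def`; 0 `sorry`; standard axioms; no decl below carries a cite tag.
-/

noncomputable section

open Set Metric Filter Topology MeasureTheory ProbabilityTheory

namespace Summit.QuantumFields.YangMills.BalabanUVNodes.N19TargetEverySource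

open Literature.MathematicalPhysics.QuantumFieldTheory.Balaban1983to89
open T4VitaliStep (tendsto_of_tendsto_at exists_seq_tendsto_zero_of_forall_Ioo tendsto_integral_of_tendsto_cgf tendsto_moment_of_tendsto_cgf)
open Summit.QuantumFields.BalabanUV.T4Continuum.NE1p.DressedMGFForm (tiltedMean)
open Summit.QuantumFields.YangMills.BalabanUVNodes.N19MGFJoinConverse (cgf_tilted_mul isProbabilityMeasure_tilted_mul)

/-! ## §1 Generic [folklore]: convergence of the cgf's on a real interval `(0, r)` propagates to EVERY complex argument of the MGF's, every real
argument of the cgf's, every tilt of the tilted means and every tilted moment — Vitali for the entire family `z ↦ ⟨e^{zX_K}⟩_K` (tree node E3) -/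

section Generic

variable {Ω : ℕ → Type*} [∀ K, MeasurableSpace (Ω K)] {μ : ∀ K, Measure (Ω K)} [∀ K, IsProbabilityMeasure (μ K)]
  {X : ∀ K, Ω K → ℝ} {B r : ℝ}

/-- **THE COMPLEX MGF's CONVERGE AT EVERY COMPLEX ARGUMENT** [folklore].  Probability measures `μ K`, observables `|X K| ≤ B` (a.e.-measurable); if
`cgf (X K) (μ K) t` converges as `K → ∞` for every real `0 < t < r` (`0 < r`), then `complexMGF (X K) (μ K) z` converges for EVERY `z ∈ ℂ` — the
tree's Vitali step `T4VitaliStep.tendsto_of_tendsto_at` on the disc of radius `‖z‖ + 1` (the family is entire, bounded by `e^{(‖z‖+1)|B|}` there). -/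
theorem tendsto_complexMGF_all_of_tendsto_cgf (hX : ∀ K, AEMeasurable (X K) (μ K)) (hB : ∀ K ω, |X K ω| ≤ B) (hr : 0 < r)
    (hconv : ∀ t : ℝ, 0 < t → t < r → ∃ y, Tendsto (fun K => cgf (X K) (μ K) t) atTop (𝓝 y)) (z : ℂ) :
    ∃ w : ℂ, Tendsto (fun K => complexMGF (X K) (μ K) z) atTop (𝓝 w) := by
  set R : ℝ := ‖z‖ + 1 with hR
  have hRpos : 0 < R := by positivity
  have hMK : ∀ K, ∀ w ∈ sphere (0 : ℂ) R, ‖complexMGF (X K) (μ K) w‖ ≤ Real.exp (R * |B|) := fun K w hw => by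
    rw [mem_sphere_zero_iff_norm] at hw
    calc ‖complexMGF (X K) (μ K) w‖ ≤ Real.exp (‖w‖ * |B|) := T4VitaliStep.norm_complexMGF_le (hX K) (hB K) w
      _ = Real.exp (R * |B|) := by rw [hw]
  obtain ⟨t, ht0, htne, ht⟩ := exists_seq_tendsto_zero_of_forall_Ioo hr hconv
  have hx0 : Tendsto (fun m => (t m : ℂ)) atTop (𝓝 0) := by
    have h := (Complex.continuous_ofReal.tendsto 0).comp ht0
    rw [Complex.ofReal_zero] at h
    exact h
  have hF : ∀ m, ∃ y, Tendsto (fun K => complexMGF (X K) (μ K) (t m)) atTop (𝓝 y) := fun m => by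
    obtain ⟨y, hy⟩ := ht m
    refine ⟨((Real.exp y : ℝ) : ℂ), ((Complex.continuous_ofReal.tendsto _).comp ((Real.continuous_exp.tendsto y).comp hy)).congr
      fun K => ?_⟩
    simp only [Function.comp_apply, complexMGF_ofReal]
    rw [exp_cgf (T4VitaliStep.integrable_exp_mul_of_bounded (hX K) (hB K) _)]
  obtain ⟨a, -, hlim⟩ := tendsto_of_tendsto_at hRpos
    (fun K => (T4VitaliStep.differentiable_complexMGF (hX K) (hB K)).diffContOnCl) hMK hx0
    (fun m => Complex.ofReal_ne_zero.2 (htne m)) hF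
  exact ⟨_, hlim z (by rw [hR]; linarith)⟩

/-- **THE REAL MGF's CONVERGE AT EVERY REAL ARGUMENT, TO A POSITIVE LIMIT** (`≥ e^{−|t|B}`). [folklore] -/
theorem tendsto_mgf_all_of_tendsto_cgf (hX : ∀ K, AEMeasurable (X K) (μ K)) (hB : ∀ K ω, |X K ω| ≤ B) (hr : 0 < r)
    (hconv : ∀ t : ℝ, 0 < t → t < r → ∃ y, Tendsto (fun K => cgf (X K) (μ K) t) atTop (𝓝 y)) (t : ℝ) :
    ∃ M : ℝ, Real.exp (-(|t| * B)) ≤ M ∧ Tendsto (fun K => mgf (X K) (μ K) t) atTop (𝓝 M) := by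
  obtain ⟨w, hw⟩ := tendsto_complexMGF_all_of_tendsto_cgf hX hB hr hconv t
  have hre : Tendsto (fun K => mgf (X K) (μ K) t) atTop (𝓝 w.re) := by
    refine ((Complex.continuous_re.tendsto w).comp hw).congr fun K => ?_
    simp only [Function.comp_apply, complexMGF_ofReal, Complex.ofReal_re]
  refine ⟨w.re, ge_of_tendsto' hre fun K => ?_, hre⟩
  have h := T4GenFunBounds.exp_neg_le_mgf_of_abs_le (hX K) (ae_of_all _ (hB K)) t
  rwa [probReal_univ, one_mul] at h

/-- **THE CGF's CONVERGE AT EVERY REAL ARGUMENT** [folklore]: convergence of `cgf (X K) (μ K)` on `(0, r)` ⇒ convergence at every `t ∈ ℝ`. -/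
theorem tendsto_cgf_all_of_tendsto_cgf (hX : ∀ K, AEMeasurable (X K) (μ K)) (hB : ∀ K ω, |X K ω| ≤ B) (hr : 0 < r)
    (hconv : ∀ t : ℝ, 0 < t → t < r → ∃ y, Tendsto (fun K => cgf (X K) (μ K) t) atTop (𝓝 y)) (t : ℝ) :
    ∃ c : ℝ, Tendsto (fun K => cgf (X K) (μ K) t) atTop (𝓝 c) := by
  obtain ⟨M, hM, hlim⟩ := tendsto_mgf_all_of_tendsto_cgf hX hB hr hconv t
  have hMpos : 0 < M := (Real.exp_pos _).trans_le hM
  exact ⟨Real.log M, ((Real.continuousAt_log hMpos.ne').tendsto).comp hlim⟩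

/-- **THE TILTED MEANS CONVERGE AT EVERY TILT** [folklore]: `X K` measurable with `|X K| ≤ B`; convergence of the cgf's on `(0, r)` ⇒ for EVERY
`s ∈ ℝ` the tilted means `tiltedMean (X K) (μ K) s` converge — node E3 (`tendsto_integral_of_tendsto_cgf`) for the TILTED probability measures
`(μ K).tilted (s·X K)`, whose cgf's are the shifted ones (`cgf_tilted_mul`) and therefore converge on `(0, 1)` by the previous theorem. -/
theorem tendsto_tiltedMean_all_of_tendsto_cgf (hXm : ∀ K, Measurable (X K)) (hB : ∀ K ω, |X K ω| ≤ B) (hr : 0 < r)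
    (hconv : ∀ t : ℝ, 0 < t → t < r → ∃ y, Tendsto (fun K => cgf (X K) (μ K) t) atTop (𝓝 y)) (s : ℝ) :
    ∃ m : ℝ, Tendsto (fun K => tiltedMean (X K) (μ K) s) atTop (𝓝 m) := by
  haveI : ∀ K, IsProbabilityMeasure ((μ K).tilted fun ω => s * X K ω) := fun K =>
    isProbabilityMeasure_tilted_mul (hXm K) (hB K) s
  have hconv' : ∀ t : ℝ, 0 < t → t < 1 →
      ∃ y, Tendsto (fun K => cgf (X K) ((μ K).tilted fun ω => s * X K ω) t) atTop (𝓝 y) := fun t _ _ => by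
    obtain ⟨c1, h1⟩ := tendsto_cgf_all_of_tendsto_cgf (fun K => (hXm K).aemeasurable) hB hr hconv (s + t)
    obtain ⟨c2, h2⟩ := tendsto_cgf_all_of_tendsto_cgf (fun K => (hXm K).aemeasurable) hB hr hconv s
    refine ⟨c1 - c2, (h1.sub h2).congr fun K => ?_⟩
    rw [cgf_tilted_mul (hXm K) (hB K)]
  exact tendsto_integral_of_tendsto_cgf (μ := fun K => (μ K).tilted fun ω => s * X K ω)
    (fun K => (hXm K).aemeasurable) hB one_pos hconv'

/-- **EVERY TILTED MOMENT CONVERGES AT EVERY TILT** [folklore]: same hypotheses ⇒ for every `s ∈ ℝ` and `n`, the moments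
`∫ (X K)ⁿ d((μ K).tilted (s·X K))` converge (node E3 `tendsto_moment_of_tendsto_cgf` for the tilted measures). -/
theorem tendsto_tiltedMoment_all_of_tendsto_cgf (hXm : ∀ K, Measurable (X K)) (hB : ∀ K ω, |X K ω| ≤ B) (hr : 0 < r)
    (hconv : ∀ t : ℝ, 0 < t → t < r → ∃ y, Tendsto (fun K => cgf (X K) (μ K) t) atTop (𝓝 y)) (s : ℝ) (n : ℕ) :
    ∃ a : ℝ, Tendsto (fun K => ∫ ω, X K ω ^ n ∂((μ K).tilted fun ω => s * X K ω)) atTop (𝓝 a) := by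
  haveI : ∀ K, IsProbabilityMeasure ((μ K).tilted fun ω => s * X K ω) := fun K =>
    isProbabilityMeasure_tilted_mul (hXm K) (hB K) s
  have hconv' : ∀ t : ℝ, 0 < t → t < 1 →
      ∃ y, Tendsto (fun K => cgf (X K) ((μ K).tilted fun ω => s * X K ω) t) atTop (𝓝 y) := fun t _ _ => by
    obtain ⟨c1, h1⟩ := tendsto_cgf_all_of_tendsto_cgf (fun K => (hXm K).aemeasurable) hB hr hconv (s + t)
    obtain ⟨c2, h2⟩ := tendsto_cgf_all_of_tendsto_cgf (fun K => (hXm K).aemeasurable) hB hr hconv s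
    refine ⟨c1 - c2, (h1.sub h2).congr fun K => ?_⟩
    rw [cgf_tilted_mul (hXm K) (hB K)]
  exact tendsto_moment_of_tendsto_cgf (μ := fun K => (μ K).tilted fun ω => s * X K ω)
    (fun K => (hXm K).aemeasurable) hB one_pos hconv' n

end Generic

/-! ## §2 At the torus scheme under N19's DECL target on ANY window: the generating functions, the sourced expectations and the sourced
moments converge at EVERY real source [bookkeeping] -/

section Scheme

open T4CauchySum (genFun genFunLim tendsto_genFun)
open T4GenFunBounds (schemeZ prodObs)
open Missing (TorusScheme)
open Summit.QuantumFields.BalabanUV.T4Continuum.Spine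
open Summit.QuantumFields.YangMills.BalabanUVNodes.N19SourcedResponse (deriv_genFun_schemeZ_eq_tiltedMean)

variable {G : Type*} [GaugeGroup G] [MeasurableSpace G] [RegularGaugeGroup G] [HaarData G] {O : Type*}
  (S : TorusScheme G O) (hβ : ∀ K, 0 ≤ S.β K) (hm : ∀ K o, Measurable (S.obs K o))
  (h1 : ∀ K o U, |S.obs K o U| ≤ 1)
include hβ hm h1

/-- Under `Target` on the window `l₀ > 0` the cgf's of the product observable under the Gibbs measures converge on `(0, l₀)` — the E3 hypothesis
(`T4CauchySum.tendsto_genFun` + `genFun_schemeZ_eq_cgf`). [bookkeeping] -/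
theorem tendsto_cgf_gibbs_of_target {vol l₀ : ℝ} {δ : ℕ → ℝ} (hl₀ : 0 < l₀) (os : List O) (hT : NE7.Target vol l₀ δ (schemeZ S os))
    (t : ℝ) (ht0 : 0 < t) (ht : t < l₀) :
    ∃ y, Tendsto (fun K => cgf (prodObs S K os) (T4GenFunBounds.gibbsMeasure (S.P K) (S.β K)) t) atTop (𝓝 y) := by
  obtain ⟨hM, hδ⟩ := hT
  refine ⟨genFunLim (schemeZ S os) t, (tendsto_genFun hM hl₀.le hδ (abs_le.2 ⟨by linarith, ht.le⟩)).congr fun K => ?_⟩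
  exact T4GenFunBounds.genFun_schemeZ_eq_cgf S hβ hm h1 K os t

/-- ★ **THE GENERATING FUNCTIONS CONVERGE AT EVERY REAL SOURCE** — not only on the window `|t| ≤ l₀` of `Target` (there: with the tree's tail rate;
outside: qualitatively).  `Target` is a HYPOTHESIS. [folklore] -/
theorem tendsto_genFun_of_target_everySource {vol l₀ : ℝ} {δ : ℕ → ℝ} (hl₀ : 0 < l₀) (os : List O)
    (hT : NE7.Target vol l₀ δ (schemeZ S os)) (t : ℝ) :
    ∃ g : ℝ, Tendsto (fun K => genFun (schemeZ S os) K t) atTop (𝓝 g) := by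
  haveI hP : ∀ K, IsProbabilityMeasure (T4GenFunBounds.gibbsMeasure (G := G) (S.P K) (S.β K)) := fun K =>
    T4GenFunBounds.isProbabilityMeasure_gibbsMeasure (G := G) (S.P K) (hβ K)
  obtain ⟨c, hc⟩ := tendsto_cgf_all_of_tendsto_cgf (μ := fun K => T4GenFunBounds.gibbsMeasure (S.P K) (S.β K))
    (X := fun K => prodObs S K os) (fun K => (T4GenFunBounds.measurable_prodObs S hm K os).aemeasurable)
    (fun K => T4GenFunBounds.abs_prodObs_le_one S h1 K os) hl₀ (tendsto_cgf_gibbs_of_target S hβ hm h1 hl₀ os hT) t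
  exact ⟨c, hc.congr fun K => (T4GenFunBounds.genFun_schemeZ_eq_cgf S hβ hm h1 K os t).symm⟩

/-- ★ **THE SOURCED EXPECTATIONS `G_K′(s)` CONVERGE AT EVERY REAL SOURCE `s`** under `Target` on any window. [folklore] -/
theorem tendsto_deriv_genFun_of_target_everySource {vol l₀ : ℝ} {δ : ℕ → ℝ} (hl₀ : 0 < l₀) (os : List O)
    (hT : NE7.Target vol l₀ δ (schemeZ S os)) (s : ℝ) :
    ∃ m : ℝ, Tendsto (fun K => deriv (genFun (schemeZ S os) K) s) atTop (𝓝 m) := by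
  haveI hP : ∀ K, IsProbabilityMeasure (T4GenFunBounds.gibbsMeasure (G := G) (S.P K) (S.β K)) := fun K =>
    T4GenFunBounds.isProbabilityMeasure_gibbsMeasure (G := G) (S.P K) (hβ K)
  obtain ⟨m, hm'⟩ := tendsto_tiltedMean_all_of_tendsto_cgf (μ := fun K => T4GenFunBounds.gibbsMeasure (S.P K) (S.β K))
    (X := fun K => prodObs S K os) (fun K => T4GenFunBounds.measurable_prodObs S hm K os)
    (fun K => T4GenFunBounds.abs_prodObs_le_one S h1 K os) hl₀ (tendsto_cgf_gibbs_of_target S hβ hm h1 hl₀ os hT) s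
  exact ⟨m, hm'.congr fun K => (deriv_genFun_schemeZ_eq_tiltedMean S hβ hm h1 K os s).symm⟩

/-- **EVERY SOURCED MOMENT CONVERGES AT EVERY REAL SOURCE**: under `Target` on any window, for every `s ∈ ℝ` and `n` the moments of the product
observable under the SOURCE-TILTED Gibbs measures `gibbs_K.tilted (s·∏os)` converge. [folklore] -/
theorem tendsto_sourcedMoment_of_target_everySource {vol l₀ : ℝ} {δ : ℕ → ℝ} (hl₀ : 0 < l₀) (os : List O)
    (hT : NE7.Target vol l₀ δ (schemeZ S os)) (s : ℝ) (n : ℕ) :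
    ∃ a : ℝ, Tendsto (fun K => ∫ U, prodObs S K os U ^ n
      ∂((T4GenFunBounds.gibbsMeasure (S.P K) (S.β K)).tilted fun U => s * prodObs S K os U)) atTop (𝓝 a) := by
  haveI hP : ∀ K, IsProbabilityMeasure (T4GenFunBounds.gibbsMeasure (G := G) (S.P K) (S.β K)) := fun K =>
    T4GenFunBounds.isProbabilityMeasure_gibbsMeasure (G := G) (S.P K) (hβ K)
  exact tendsto_tiltedMoment_all_of_tendsto_cgf (μ := fun K => T4GenFunBounds.gibbsMeasure (S.P K) (S.β K))
    (X := fun K => prodObs S K os) (fun K => T4GenFunBounds.measurable_prodObs S hm K os)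
    (fun K => T4GenFunBounds.abs_prodObs_le_one S h1 K os) hl₀ (tendsto_cgf_gibbs_of_target S hβ hm h1 hl₀ os hT) s n

end Scheme

end Summit.QuantumFields.YangMills.BalabanUVNodes.N19TargetEverySource

end
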